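import Mathlib
import HarnessLib

/-!
# Route MonotoneRestoration, crux `MonotoneRestorationQP` (stmt-15886), line `linear-width` —
# caterpillar moments align a matrix with distinct row sums and distinct column sums

Helper file (`--supports stmt-ValiantsHypothesis-15886`), pure linear algebra, def-free.  It is the
algebraic half of the CERTIFIED SATURATION REMARK behind the registered stub `stub_degreeLifting`
(`LinearDegreeWidthRestoration → WidthRestorationQP`) of `Cruxes/MonotoneRestorationQP/Lines/linear_width.lean`:
the width hypothesis `PolylogHomDetermined` holds "for free" for `Disc(row sums)²·Disc(col sums)²·h`,
whatever the matrix-symmetric `h` — because below the non-vanishing locus of the two discriminants a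
point `A ∈ ℂ^{n×n}` is determined UP TO ROW AND COLUMN PERMUTATIONS by its CATERPILLAR MOMENTS

  `Σ_u r_u^m`,  `Σ_v c_v^m`,  `Σ_{u,v} r_u^m · A_uv · c_v^{m'}`   (`r` = row sums, `c` = column sums),

which are the values at `A` of the homomorphism polynomials of stars and double stars (trees; file
`…LinearWidthCaterpillarHom.lean`).  Contents:

* `sum_polynomial_eval_eq` — equal power sums ⇒ equal `Σ_u P(r_u)` for every polynomial `P`;
* `injective_of_psum_eq` — equal power sums transport injectivity (Hankel = `Vᵀ V` for the Vandermonde `V`);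
* `exists_perm_of_psum_eq` — equal power sums and injectivity ⇒ the tuples differ by a permutation;
* `exists_perms_of_moments` — THE ALIGNMENT: equal caterpillar moments, distinct row sums and distinct
  column sums of `A` ⇒ `B = A ∘ (σ × τ)` for permutations `σ, τ`;
* `eval_eq_of_moments_of_matrixSymmetric` — hence every matrix-symmetric polynomial takes the same value
  at `A` and `B`.
-/

-- `Summit.ValiantsHypothesis.ValiantsHypothesis.…` is the tree's mandated namespace (Sub = Summit).
set_option linter.dupNamespace false

noncomputable section

namespace Summit.ValiantsHypothesis.ValiantsHypothesis.Theorems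

namespace MomentAlignment

open Matrix Polynomial Finset

variable {n : ℕ}

/-- Equal power sums give equal sums of values of every polynomial. [folklore] -/
theorem sum_polynomial_eval_eq {r r' : Fin n → ℂ} (hp : ∀ m : ℕ, ∑ u, r u ^ m = ∑ u, r' u ^ m)
    (P : ℂ[X]) : ∑ u, P.eval (r u) = ∑ u, P.eval (r' u) := by
  have h : ∀ (s : Fin n → ℂ), ∑ u, P.eval (s u) =
      ∑ i ∈ Finset.range (P.natDegree + 1), P.coeff i * ∑ u, s u ^ i := by
    intro s
    simp only [Polynomial.eval_eq_sum_range, Finset.mul_sum]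
    exact Finset.sum_comm
  rw [h r, h r']
  exact Finset.sum_congr rfl fun i _ => by rw [hp i]

/-- The Hankel matrix of power sums is `Vᵀ V` for the Vandermonde matrix `V`. [folklore] -/
theorem vandermonde_transpose_mul_vandermonde (r : Fin n → ℂ) (i j : Fin n) :
    ((vandermonde r)ᵀ * vandermonde r) i j = ∑ u, r u ^ ((i : ℕ) + (j : ℕ)) := by
  simp only [mul_apply, transpose_apply, vandermonde_apply, ← pow_add]

/-- **Equal power sums transport injectivity** (`det (Vᵀ V) = det V ²` and the Hankel matrices
agree). [folklore] -/
theorem injective_of_psum_eq {r r' : Fin n → ℂ} (hp : ∀ m : ℕ, ∑ u, r u ^ m = ∑ u, r' u ^ m)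
    (hr : Function.Injective r) : Function.Injective r' := by
  have hV : (vandermonde r')ᵀ * vandermonde r' = (vandermonde r)ᵀ * vandermonde r := by
    ext i j
    rw [vandermonde_transpose_mul_vandermonde, vandermonde_transpose_mul_vandermonde, hp]
  have hdet : det (vandermonde r) ≠ 0 := (det_vandermonde_ne_zero_iff).2 hr
  have h := congrArg det hV
  rw [det_mul, det_transpose, det_mul, det_transpose] at h
  have hdet' : det (vandermonde r') ≠ 0 := by
    intro h0
    rw [h0, zero_mul] at h
    exact mul_ne_zero hdet hdet h.symm
  exact (det_vandermonde_ne_zero_iff).1 hdet'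

/-- **Equal power sums and distinct values ⇒ the tuples differ by a permutation.** [folklore] -/
theorem exists_perm_of_psum_eq {r r' : Fin n → ℂ} (hp : ∀ m : ℕ, ∑ u, r u ^ m = ∑ u, r' u ^ m)
    (hr : Function.Injective r) : ∃ σ : Equiv.Perm (Fin n), ∀ u, r' u = r (σ u) := by
  have hr' : Function.Injective r' := injective_of_psum_eq hp hr
  -- every value of `r'` is a value of `r`
  have key : ∀ u₀ : Fin n, ∃ w, r' u₀ = r w := by
    intro u₀
    classical
    set Z : ℂ[X] := ∏ w, (X - C (r w)) with hZ
    set Q : ℂ[X] := ∏ w ∈ univ.erase u₀, (X - C (r' w)) with hQ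
    have h1 : ∑ u, (Z * Q).eval (r u) = 0 := by
      refine Finset.sum_eq_zero fun u _ => ?_
      have hZ0 : Z.eval (r u) = 0 := by
        rw [hZ, eval_prod]
        exact Finset.prod_eq_zero (Finset.mem_univ u) (by simp)
      rw [eval_mul, hZ0, zero_mul]
    have h2 : ∑ u, (Z * Q).eval (r' u) = (Z * Q).eval (r' u₀) := by
      refine Finset.sum_eq_single u₀ (fun u _ hu => ?_) (by simp)
      have hQ0 : Q.eval (r' u) = 0 := by
        rw [hQ, eval_prod]
        exact Finset.prod_eq_zero (Finset.mem_erase.2 ⟨hu, Finset.mem_univ u⟩) (by simp)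
      rw [eval_mul, hQ0, mul_zero]
    have h3 : (Z * Q).eval (r' u₀) = 0 := by rw [← h2, ← sum_polynomial_eval_eq hp, h1]
    rw [eval_mul, mul_eq_zero] at h3
    rcases h3 with hz | hq
    · rw [hZ, eval_prod, Finset.prod_eq_zero_iff] at hz
      obtain ⟨w, -, hw⟩ := hz
      exact ⟨w, by simpa [sub_eq_zero] using hw⟩
    · rw [hQ, eval_prod, Finset.prod_eq_zero_iff] at hq
      obtain ⟨w, hw, hw0⟩ := hq
      have : r' u₀ = r' w := by simpa [sub_eq_zero] using hw0
      exact absurd (hr' this) (Finset.ne_of_mem_erase hw).symm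
  choose σ₀ hσ₀ using key
  have hinj : Function.Injective σ₀ := fun u v h => hr' (by rw [hσ₀ u, hσ₀ v, h])
  exact ⟨Equiv.ofBijective σ₀ (Finite.injective_iff_bijective.1 hinj), fun u => hσ₀ u⟩

/-- The mixed caterpillar moments are the entries of `Vrᵀ · A · Vc`. [folklore] -/
theorem moment_eq_entry (A : Fin n × Fin n → ℂ) (r c : Fin n → ℂ) (i j : Fin n) :
    ((vandermonde r)ᵀ * Matrix.of (fun u v => A (u, v)) * vandermonde c) i j =
      ∑ u, ∑ v, r u ^ (i : ℕ) * A (u, v) * c v ^ (j : ℕ) := by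
  simp only [mul_apply, transpose_apply, vandermonde_apply, of_apply, Finset.sum_mul]
  rw [Finset.sum_comm]

/-- **THE ALIGNMENT.** If `A, B ∈ ℂ^{n×n}` have the same caterpillar moments — power sums of row sums,
power sums of column sums, and mixed moments `Σ_{u,v} r_u^m A_uv c_v^{m'}` for `m, m' < n` — and the
row sums of `A` are pairwise distinct and so are its column sums, then `B` is `A` with rows and columns
permuted. [folklore] -/
theorem exists_perms_of_moments (A B : Fin n × Fin n → ℂ)
    (hR : ∀ m : ℕ, ∑ u, (∑ j, A (u, j)) ^ m = ∑ u, (∑ j, B (u, j)) ^ m)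
    (hC : ∀ m : ℕ, ∑ v, (∑ i, A (i, v)) ^ m = ∑ v, (∑ i, B (i, v)) ^ m)
    (hM : ∀ i j : Fin n, ∑ u, ∑ v, (∑ j', A (u, j')) ^ (i : ℕ) * A (u, v) * (∑ i', A (i', v)) ^ (j : ℕ) =
      ∑ u, ∑ v, (∑ j', B (u, j')) ^ (i : ℕ) * B (u, v) * (∑ i', B (i', v)) ^ (j : ℕ))
    (hr : Function.Injective fun u => ∑ j, A (u, j))
    (hc : Function.Injective fun v => ∑ i, A (i, v)) :
    ∃ σ τ : Equiv.Perm (Fin n), ∀ u v, B (u, v) = A (σ u, τ v) := by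
  obtain ⟨σ, hσ⟩ := exists_perm_of_psum_eq hR hr
  obtain ⟨τ, hτ⟩ := exists_perm_of_psum_eq hC hc
  set r : Fin n → ℂ := fun u => ∑ j, A (u, j) with hrdef
  set c : Fin n → ℂ := fun v => ∑ i, A (i, v) with hcdef
  -- `B` re-indexed so that its row/column sums align with those of `A`
  set Bt : Fin n × Fin n → ℂ := fun p => B (σ.symm p.1, τ.symm p.2) with hBt
  have hmat : (vandermonde r)ᵀ * Matrix.of (fun u v => A (u, v)) * vandermonde c =
      (vandermonde r)ᵀ * Matrix.of (fun u v => Bt (u, v)) * vandermonde c := by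
    ext i j
    rw [moment_eq_entry, moment_eq_entry, hM i j]
    -- reindex the `B`-side sum by `σ, τ`
    have : ∑ u, ∑ v, (∑ j', B (u, j')) ^ (i : ℕ) * B (u, v) * (∑ i', B (i', v)) ^ (j : ℕ) =
        ∑ u, ∑ v, r (σ u) ^ (i : ℕ) * B (u, v) * c (τ v) ^ (j : ℕ) := by
      refine Finset.sum_congr rfl fun u _ => Finset.sum_congr rfl fun v _ => ?_
      rw [show (∑ j', B (u, j')) = r (σ u) from hσ u, show (∑ i', B (i', v)) = c (τ v) from hτ v]
    have e1 : ∑ u, ∑ v, r u ^ (i : ℕ) * Bt (u, v) * c v ^ (j : ℕ) =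
        ∑ u, ∑ v, r (σ u) ^ (i : ℕ) * Bt (σ u, τ v) * c (τ v) ^ (j : ℕ) := by
      rw [← Equiv.sum_comp σ (fun u => ∑ v, r u ^ (i : ℕ) * Bt (u, v) * c v ^ (j : ℕ))]
      refine Finset.sum_congr rfl fun u _ => ?_
      exact (Equiv.sum_comp τ (fun v => r (σ u) ^ (i : ℕ) * Bt (σ u, v) * c v ^ (j : ℕ))).symm
    rw [this, e1]
    simp [hBt]
  have hVr : IsUnit (det (vandermonde r)ᵀ) := by
    rw [det_transpose]; exact isUnit_iff_ne_zero.2 ((det_vandermonde_ne_zero_iff).2 hr)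
  have hVc : IsUnit (det (vandermonde c)) := isUnit_iff_ne_zero.2 ((det_vandermonde_ne_zero_iff).2 hc)
  have hcancel : Matrix.of (fun u v => A (u, v)) = Matrix.of (fun u v => Bt (u, v)) := by
    have h1 := congrArg (fun M => M * (vandermonde c)⁻¹) hmat
    simp only [Matrix.mul_assoc, Matrix.mul_nonsing_inv _ hVc, Matrix.mul_one] at h1
    have h2 := congrArg (fun M => ((vandermonde r)ᵀ)⁻¹ * M) h1
    simp only [← Matrix.mul_assoc, Matrix.nonsing_inv_mul _ hVr, Matrix.one_mul] at h2
    exact h2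
  refine ⟨σ, τ, fun u v => ?_⟩
  have := congrFun (congrFun hcancel (σ u)) (τ v)
  simpa [hBt] using this.symm

/-- **Consequence for matrix-symmetric polynomials**: under the hypotheses of
`exists_perms_of_moments`, every polynomial invariant under independent row and column permutations
takes the same value at `A` and at `B`. [folklore] -/
theorem eval_eq_of_moments_of_matrixSymmetric (A B : Fin n × Fin n → ℂ)
    (hR : ∀ m : ℕ, ∑ u, (∑ j, A (u, j)) ^ m = ∑ u, (∑ j, B (u, j)) ^ m)
    (hC : ∀ m : ℕ, ∑ v, (∑ i, A (i, v)) ^ m = ∑ v, (∑ i, B (i, v)) ^ m)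
    (hM : ∀ i j : Fin n, ∑ u, ∑ v, (∑ j', A (u, j')) ^ (i : ℕ) * A (u, v) * (∑ i', A (i', v)) ^ (j : ℕ) =
      ∑ u, ∑ v, (∑ j', B (u, j')) ^ (i : ℕ) * B (u, v) * (∑ i', B (i', v)) ^ (j : ℕ))
    (hr : Function.Injective fun u => ∑ j, A (u, j))
    (hc : Function.Injective fun v => ∑ i, A (i, v))
    (q : MvPolynomial (Fin n × Fin n) ℂ)
    (hq : ∀ σ τ : Equiv.Perm (Fin n),
      MvPolynomial.rename (fun p : Fin n × Fin n => (σ p.1, τ p.2)) q = q) :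
    MvPolynomial.eval A q = MvPolynomial.eval B q := by
  obtain ⟨σ, τ, h⟩ := exists_perms_of_moments A B hR hC hM hr hc
  have hB : B = A ∘ fun p : Fin n × Fin n => (σ p.1, τ p.2) := funext fun p => h p.1 p.2
  rw [hB, ← MvPolynomial.eval_rename, hq]

end MomentAlignment

end Summit.ValiantsHypothesis.ValiantsHypothesis.Theorems

end
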